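import Summits.NavierStokesRegularity.NavierStokesRegularity.Theorems.FilamentSkeletonRssKelvinGateSmoothing
import Summits.NavierStokesRegularity.NavierStokesRegularity.Theorems.FilamentSkeletonRssKelvinGateDefs
import Literature.Analysis.FluidPDE.BurgersVortex

/-!
# Route `FilamentSkeletonRss` · crux `TransverseReduction1AG` (stmt-NavierStokesRegularity-27853) — line of record `defect_column_gate_1AG`:
# the line's VOCABULARY as importable route-posited definitions (so that stub proofs can state the registered stubs BY NAME)

Definitions (+ three tiny sorry-free lemmas), `--supports stmt-NavierStokesRegularity-27853 --as helper`.  Author of the texts: strategist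
`cstrat-stmt-NavierStokesRegularity-21221-g3` (tree `Cruxes/TransverseReductionRJ/Lines/defect_column_gate_1AG.lean`, sha16 6198e7c4afcffc7b);
the S3 split `DefectContinuity1AG` / `ClosingIVT1AG` by the LEAD of 27853 (lane ns-filament-21221-p1 g9, DIRECTOR-NS #238).  Moved VERBATIM into
`Theorems/` by the lead because a crux workfile (which carries `sorry`d stubs) cannot be imported by a sorry-free stub proof, and the gate's
by-name stub matcher wants `theorem stub_<name> : <StubProp>` with the registered signature text; with this file both the skeleton and every stub
proof `open Summit.NavierStokesRegularity.NavierStokesRegularity.Theorems.DefectColumnGate` and speak the same constants.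

Contents: §1 the crux cut at its arrows (`DefU1 … Clauses1G`, `Concl1`, `CutForm1AG`, `transverseReduction1AG_iff := Iff.rfl`); §2 the rate column
`rateGen`, the re-wound defect family spec `FamilySpec1AG`, the defect-bordered gate spec `DefectGateSpec1AG`, `AlmostConcl1AG`; §3 the stub
statements `RateSelection1AG` (S0), `DefectFamily1AG` / `FamilyDressing1AG` (S1), `DefectGate1AG` (S2), `DefectClosing1AG` (S3) and its lead split
`DefectContinuity1AG` (S3b) / `ClosingIVT1AG` (S3a); §4 the frozen waist-column model (`secPt`, `secWt`, `colSwirl`, `colBase`, `colForceVort`) and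
`WaistColumnGate1A` (S2a), `GateAssembly1AG` (S2b).  All statements are `def … : Prop` and are NEVER asserted here.
HONEST FRAMING: bookkeeping for a HYPOTHETICAL filament-type rotating-self-similar blow-up route (MODEL rung, negative side); nothing here
bears on Navier–Stokes regularity; `TransverseReduction1AG` is neither proved nor refuted.
-/

set_option linter.dupNamespace false

noncomputable section

namespace Summit.NavierStokesRegularity.NavierStokesRegularity.Theorems.DefectColumnGate

open scoped BigOperators Topology Manifold Classical MeasureTheory ProbabilityTheory Matrix InnerProductSpace ComplexConjugate ContinuousMap ENNReal ContDiff
open Filter Set Function TopologicalSpace MeasureTheory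
open Literature.NS
open Literature.Analysis.FluidPDE
open Summit.NavierStokesRegularity.NavierStokesRegularity.Theses.FilamentSkeletonRss
open Summit.NavierStokesRegularity.NavierStokesRegularity.Theorems.KelvinGate (lerayOp lerayLin XBound YBound LocClose)

/-! ## 1. The crux, cut at its arrows (texts VERBATIM from the route decl `TransverseReduction1AG`, route file rev 24) -/

/-- Defining hypothesis 1 (core-MATCHED regularised Biot–Savart field of a filament configuration `Z` with core areas `Aa`). -/
def DefU1 (N : ℕ) (Γ : ℝ) (γ : Fin N → ℝ) (Aa : Fin N → ℝ → ℝ) (u : (Fin N → ℝ → EuclideanSpace ℝ (Fin 3)) → EuclideanSpace ℝ (Fin 3) → EuclideanSpace ℝ (Fin 3)) : Prop :=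
  ∀ Z y, u Z y = ∑ k, (Γ*γ k/(4*Real.pi))•∫ σ:ℝ, ((‖y-Z k σ‖^2+Real.exp (-(1+Real.eulerMascheroniConstant-Real.log 2))*Aa k σ)^(3/2:ℝ))⁻¹•cross (deriv (Z k) σ) (y-Z k σ)

/-- Defining hypothesis 2 (frame field `v = u_X + ½y − α e₃×y`). -/
def DefV1 (N : ℕ) (α : ℝ) (X : Fin N → ℝ → EuclideanSpace ℝ (Fin 3)) (u : (Fin N → ℝ → EuclideanSpace ℝ (Fin 3)) → EuclideanSpace ℝ (Fin 3) → EuclideanSpace ℝ (Fin 3)) (v : EuclideanSpace ℝ (Fin 3) → EuclideanSpace ℝ (Fin 3)) : Prop :=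
  ∀ y, v y = u X y+(1/2:ℝ)•y-α•cross (EuclideanSpace.single 2 1) y

/-- Defining hypothesis 3 (velocity gradient at the stagnation points). -/
def DefA1 (N : ℕ) (X : Fin N → ℝ → EuclideanSpace ℝ (Fin 3)) (c : Fin N → ℝ) (v : EuclideanSpace ℝ (Fin 3) → EuclideanSpace ℝ (Fin 3)) (A : Fin N → (EuclideanSpace ℝ (Fin 3) →L[ℝ] EuclideanSpace ℝ (Fin 3))) : Prop :=
  ∀ j, A j = fderiv ℝ v (X j (c j))

/-- Defining hypothesis 4 (normal part of the frame velocity along a configuration: the filament-equilibrium map `T`). -/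
def DefT1 (N : ℕ) (α : ℝ) (u : (Fin N → ℝ → EuclideanSpace ℝ (Fin 3)) → EuclideanSpace ℝ (Fin 3) → EuclideanSpace ℝ (Fin 3)) (T : (Fin N → ℝ → EuclideanSpace ℝ (Fin 3)) → Fin N → ℝ → EuclideanSpace ℝ (Fin 3)) : Prop :=
  ∀ Z j τ, T Z j τ = (u Z (Z j τ)+(1/2:ℝ)•Z j τ-α•cross (EuclideanSpace.single 2 1) (Z j τ))-(⟪u Z (Z j τ)+(1/2:ℝ)•Z j τ-α•cross (EuclideanSpace.single 2 1) (Z j τ), deriv (Z j) τ⟫_ℝ/‖deriv (Z j) τ‖^2)•deriv (Z j) τ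


/-- The `SkeletonJ1G` clause block of the crux's hypothesis (clauses 1–13J + the core-area law + the Γ-flat all-τ cone bound with
constant `KA`), VERBATIM. -/
def Clauses1G (N : ℕ) (Γ δ ρ K Λ a b cnd Rw Rb cg θ₀ KA : ℝ) (γ : Fin N → ℝ) (α : ℝ) (X : Fin N → ℝ → EuclideanSpace ℝ (Fin 3)) (w : Fin N → ℝ → ℝ) (c : Fin N → ℝ) (m n : Fin N → EuclideanSpace ℝ (Fin 3)) (Aa : Fin N → ℝ → ℝ) (v : EuclideanSpace ℝ (Fin 3) → EuclideanSpace ℝ (Fin 3)) (A : Fin N → (EuclideanSpace ℝ (Fin 3) →L[ℝ] EuclideanSpace ℝ (Fin 3))) (T : (Fin N → ℝ → EuclideanSpace ℝ (Fin 3)) → Fin N → ℝ → EuclideanSpace ℝ (Fin 3)) : Prop :=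
  (α ≠ 0 ∧ (∀ j, γ j ≠ 0)∧(∀ j, ContDiff ℝ 2 (X j) ∧ Differentiable ℝ (w j)∧(∀ τ, ‖deriv (X j) τ‖ = 1)∧(∀ τ, ‖iteratedDeriv 2 (X j) τ‖*√Γ≤K) ∧ Tendsto (fun τ => ‖X j τ‖) (cocompact ℝ) atTop)∧(∀ j k, j ≠ k → ∀ τ σ, ρ*√Γ≤‖X j τ-X k σ‖)∧(∀ j τ σ, ρ*√Γ≤|τ-σ| → cg*ρ*√Γ≤‖X j τ-X j σ‖)∧(∀ j τ, cg*|τ-c j|≤Rw*√Γ+‖X j τ‖)∧(∀ j τ, w j τ = ⟪v (X j τ), deriv (X j) τ⟫_ℝ)∧(∀ j τ, ‖X j τ‖≤Rb*√(Γ*Real.log Γ) → v (X j τ) = w j τ•deriv (X j) τ)∧(∀ j, ‖X j (c j)‖≤Rw*√Γ)∧(∀ j, |⟪deriv (X j) (c j), EuclideanSpace.single 2 1⟫_ℝ|≤1-θ₀)∧(θ₀≤|α| ∧ |α|≤θ₀⁻¹ ∧ ∀ j, θ₀≤|γ j| ∧ |γ j|≤θ₀⁻¹)∧(∀ j, w j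 (c j) = 0 ∧ (∀ τ, w j τ = 0 → τ = c j) ∧ 3/2+δ≤deriv (w j) (c j) ∧ deriv (w j) (c j)≤Λ)∧(∀ j, Differentiable ℝ (Aa j) ∧ (∀ τ, 0 < Aa j τ) ∧ ∀ τ, w j τ*deriv (Aa j) τ = (3/2-deriv (w j) τ)*Aa j τ+4)∧(∀ j τ, Rw^2*Γ*Aa j τ≤KA*(Rw^2*Γ+‖X j τ‖^2))∧(∀ j, Orthonormal ℝ ![deriv (X j) (c j), m j, n j] ∧ ⟪A j (m j), m j⟫_ℝ+⟪A j (n j), n j⟫_ℝ < 0 ∧ ⟪A j (n j), m j⟫_ℝ * ⟪A j (m j), n j⟫_ℝ < ⟪A j (m j), m j⟫_ℝ * ⟪A j (n j), n j⟫_ℝ)∧(∀ Y:Fin N → ℝ → EuclideanSpace ℝ (Fin 3), (∀ j, ContDiff ℝ 2 (Y j))→(∀ j τ, ⟪Y j τ, deriv (X j) τ⟫_ℝ = 0) → (∀ j τ, Rb*√(Γ*Real.log Γ) < ‖X j τ‖ → Y j τ = 0) → ∑ j, ⟪Y j (c j), cross (EuclideanSpace.single 2 1) (X j (c j))⟫_ℝ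 = 0 → (∀ j τ, ‖Y j τ‖+‖deriv (Y j) τ‖+‖iteratedDeriv 2 (Y j) τ‖≤(1+|τ-c j|)^b) → ∀ L:ℝ, (∀ j τ, ‖deriv (fun s:ℝ => T (fun k σ => X k σ+s•Y k σ) j τ) 0‖≤L*(1+|τ-c j|)^a) → ∀ j τ, ‖Y j τ‖≤cnd*L*(1+|τ-c j|)^b))

/-- The crux's conclusion block for a candidate `(α₁, C₀, M, U, P)`, VERBATIM. -/
def Concl1 (N : ℕ) (Γ ρ η Rw : ℝ) (X : Fin N → ℝ → EuclideanSpace ℝ (Fin 3)) (u : (Fin N → ℝ → EuclideanSpace ℝ (Fin 3)) → EuclideanSpace ℝ (Fin 3) → EuclideanSpace ℝ (Fin 3)) (α₁ C₀ M : ℝ) (U : EuclideanSpace ℝ (Fin 3) → EuclideanSpace ℝ (Fin 3)) (P : EuclideanSpace ℝ (Fin 3) → ℝ) : Prop :=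
  α₁ ≠ 0 ∧ U ≠ 0 ∧ ContDiff ℝ (⊤:ℕ∞) U ∧ ContDiff ℝ (⊤:ℕ∞) P ∧ VectorCalculus.IsDivFree U∧(∀ y, α₁•(cross (EuclideanSpace.single 2 1) (U y)-fderiv ℝ U y (cross (EuclideanSpace.single 2 1) y))+(1/2:ℝ)•U y+(1/2:ℝ)•fderiv ℝ U y y-(Laplacian.laplacian U) y+fderiv ℝ U y (U y)+gradient P y = 0)∧(∀ y, ‖U y‖≤C₀/(1+‖y‖))∧(∀ y, |P y|≤M)∧(∀ y, ‖y‖≤Rw*√Γ → (∀ j τ, ρ*√Γ/4≤‖y-X j τ‖) → ‖U y-u X y‖≤η*√Γ)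


/-- The CUT FORM of the crux: hypotheses `DefU1 … Clauses1G`, conclusion `Concl1` (an `abbrev`, so that the line's glue theorem
concludes THIS constant and only `TransverseReduction1AG_of` below concludes the crux by name — skeleton A12 shape). -/
abbrev CutForm1AG : Prop :=
    ∀ (N : ℕ) (δ ρ K Λ a b cnd η Rw Rb cg θ₀ KA : ℝ), 0 < N → 0 < δ → 0 < ρ → 0 ≤ a → 0 < η → 0 < Rw → 0 < Rb → 0 < cg → 0 < θ₀ → ∃ Γ₁ : ℝ, ∀ Γ : ℝ, Γ₁ ≤ Γ → ∀ (γ : Fin N → ℝ) (α : ℝ) (X : Fin N → ℝ → EuclideanSpace ℝ (Fin 3)) (w : Fin N → ℝ → ℝ) (c : Fin N → ℝ) (m n : Fin N → EuclideanSpace ℝ (Fin 3)) (Aa : Fin N → ℝ → ℝ) (u : (Fin N → ℝ → EuclideanSpace ℝ (Fin 3)) → EuclideanSpace ℝ (Fin 3) → EuclideanSpace ℝ (Fin 3)) (v : EuclideanSpace ℝ (Fin 3) → EuclideanSpace ℝ (Fin 3)) (A : Fin N → (EuclideanSpace ℝ (Fin 3) →L[ℝ] EuclideanSpace ℝ (Fin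 3))) (T : (Fin N → ℝ → EuclideanSpace ℝ (Fin 3)) → Fin N → ℝ → EuclideanSpace ℝ (Fin 3)),
      DefU1 N Γ γ Aa u → DefV1 N α X u v → DefA1 N X c v A → DefT1 N α u T → Clauses1G N Γ δ ρ K Λ a b cnd Rw Rb cg θ₀ KA γ α X w c m n Aa v A T → ∃ (α₁ C₀ M : ℝ) (U : EuclideanSpace ℝ (Fin 3) → EuclideanSpace ℝ (Fin 3)) (P : EuclideanSpace ℝ (Fin 3) → ℝ), Concl1 N Γ ρ η Rw X u α₁ C₀ M U P

/-- CERTIFICATE that §1 is the crux: the route decl unfolds to the cut form by `Iff.rfl`. -/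
theorem transverseReduction1AG_iff : TransverseReduction1AG ↔ CutForm1AG :=
  Iff.rfl


/-! ## 2. Vocabulary of the line (`lerayOp`, `lerayLin`, `XBound`, `YBound`, `LocClose` are the landed tools of
`Theorems.FilamentSkeletonRssKelvinGateDefs`, opened by name; NEW: the rate column, the family spec, the defect-gate spec) -/

/-- The RATE COLUMN `𝓡U (y) = e₃ × U(y) − DU(y)[e₃ × y]` — the derivative of the profile operator in the rate:
`lerayOp (α+β) U y = lerayOp α U y + β • rateGen U y`.  At an exact profile it is the e₃-ROTATION KERNEL VECTOR of the
linearisation (kit ns-idea-12 §10.4 (1)); cut off, it is the defect column `Z_β` of this line. -/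
def rateGen (U : EuclideanSpace ℝ (Fin 3) → EuclideanSpace ℝ (Fin 3)) (y : EuclideanSpace ℝ (Fin 3)) : EuclideanSpace ℝ (Fin 3) :=
  cross (EuclideanSpace.single 2 1) (U y) - fderiv ℝ U y (cross (EuclideanSpace.single 2 1) y)

/-- **Spec of S1 · RE-WOUND DEFECT FAMILY of order `k` at ONE skeleton.**  A base rate `α⁰` within `θ₀/4` of the skeleton's rate,
a NARROW window `0 < β₀ ≤ min(θ₀/4, 2Γ^(−q₁))`, and for every `|β| ≤ β₀` a smooth divergence-free field `U⁰_β` with pressure `P⁰_β` such that: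
polynomial X-size `Cs·Γ⁴`, pressure bounded likewise, NON-DEGENERATE (`|U⁰_β(y₀)| ≥ 1` at some `|y₀| ≤ Cs`), `η√Γ/2`-close to the
skeleton field `u_X` off the `ρ√Γ/4`-tubes in the waist ball, and the profile equation AT THE EXACT FRAME RATE `α⁰+β` holds up to
a Y-residual of size `Cr·Γ^(−k)` PLUS A SCALAR MULTIPLE `g(β)` OF THE DEFECT COLUMN `Z_β`; the defect column is the rate column
`𝓡U⁰_β` inside `‖y‖ ≤ 2Rb√(Γ log Γ)`, vanishes outside `‖y‖ ≥ 4Rb√(Γ log Γ)`, and is Y-bounded by `Cs·Γ⁶` (compact support: it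
carries no far field — this is the O1 repair); the scalar defect `g` is continuous and CHANGES SIGN across the window with margin
`Γ^(−q₁)` and stays `≤ Cs·Γ^(−q₁)` (so every member is an approximate profile to accuracy `Γ^(6−q₁)`, polynomially small once
`q₁` is large — the gate S2b chooses the threshold `q₀`); the family, its residual and its column are locally `C¹`-continuous in `β`.  (Heuristically `g(β) ≈ β`: inside the ball
the structure stays balanced at the selected rate `α⁰`, the ends are re-wound at the frame rate `α⁰+β`; `α⁰` itself is the
order-`k` selected rate, which is where `RateSelection1AG` is used.) -/
def FamilySpec1AG (N : ℕ) (Γ ρ η Rw Rb θ₀ : ℝ) (k : ℕ) (Cs Cr q₁ : ℝ) (α : ℝ) (X : Fin N → ℝ → EuclideanSpace ℝ (Fin 3)) (u : (Fin N → ℝ → EuclideanSpace ℝ (Fin 3)) → EuclideanSpace ℝ (Fin 3) → EuclideanSpace ℝ (Fin 3)) (α0 β₀ : ℝ) (U0 : ℝ → EuclideanSpace ℝ (Fin 3) → EuclideanSpace ℝ (Fin 3)) (P0 : ℝ → EuclideanSpace ℝ (Fin 3) → ℝ) (Z : ℝ → EuclideanSpace ℝ (Fin 3) → EuclideanSpace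 ℝ (Fin 3)) (g : ℝ → ℝ) (r : ℝ → EuclideanSpace ℝ (Fin 3) → EuclideanSpace ℝ (Fin 3)) : Prop :=
  0 < β₀ ∧ β₀ ≤ θ₀ / 4 ∧ β₀ ≤ 2 * Γ ^ (-q₁) ∧ |α0 - α| ≤ θ₀ / 4 ∧
  ContinuousOn g (Icc (-β₀) β₀) ∧
  ((g (-β₀) ≤ -Γ ^ (-q₁) ∧ Γ ^ (-q₁) ≤ g β₀) ∨ (g β₀ ≤ -Γ ^ (-q₁) ∧ Γ ^ (-q₁) ≤ g (-β₀))) ∧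
  (∀ β : ℝ, |β| ≤ β₀ →
    ContDiff ℝ (⊤:ℕ∞) (U0 β) ∧ ContDiff ℝ (⊤:ℕ∞) (P0 β) ∧ VectorCalculus.IsDivFree (U0 β) ∧
    XBound (U0 β) (Cs * Γ ^ 4) ∧ (∀ y, |P0 β y| ≤ Cs * Γ ^ 4) ∧ (∃ y₀, ‖y₀‖ ≤ Cs ∧ 1 ≤ ‖U0 β y₀‖) ∧
    (∀ y, ‖y‖ ≤ Rw * √Γ → (∀ j τ, ρ * √Γ / 4 ≤ ‖y - X j τ‖) → ‖U0 β y - u X y‖ ≤ η * √Γ / 2) ∧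
    YBound (Z β) (Cs * Γ ^ 6) ∧ (∀ y, ‖y‖ ≤ 2 * Rb * √(Γ * Real.log Γ) → Z β y = rateGen (U0 β) y) ∧
    (∀ y, 4 * Rb * √(Γ * Real.log Γ) ≤ ‖y‖ → Z β y = 0) ∧
    YBound (r β) (Cr * Γ ^ (-(k:ℝ))) ∧ |g β| ≤ Cs * Γ ^ (-q₁) ∧
    (∀ y, lerayOp (α0 + β) (U0 β) y + gradient (P0 β) y = r β y + g β • Z β y)) ∧
  (∀ β : ℝ, |β| ≤ β₀ → ∀ L ε : ℝ, 0 < ε → ∃ δ' : ℝ, 0 < δ' ∧ ∀ β' : ℝ, |β'| ≤ β₀ → |β' - β| < δ' →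
    LocClose (U0 β') (U0 β) L ε ∧ LocClose (Z β') (Z β) L ε ∧ (∀ y, ‖y‖ ≤ L → ‖r β' y - r β y‖ ≤ ε) ∧ |g β' - g β| ≤ ε)

/-- **Spec of S2 · DEFECT-BORDERED FROZEN-RATE GATE with polynomial loss.**  For every member `|β| ≤ β₀` of the family: a RIGHT
INVERSE `F ↦ (𝓚_β F, 𝓠_β F, 𝓫_β F)` of the linearised profile operator at `(α⁰+β, U⁰_β)` BORDERED ON THE RANGE SIDE by the
compactly supported defect column `Z_β`: `𝓛_(α⁰+β, U⁰_β)(𝓚F) + ∇(𝓠F) + (𝓫F)·Z_β = F`, `div 𝓚F = 0`, with `X-size(𝓚F), |𝓠F|,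
|𝓫F| ≤ C₂ Γ^κ · Y-size(F)` (1); linear in `F` (2); TIGHT uniformly in `β` (uniformly Y-bounded forcings that are small on a large
ball give locally small velocity response and small defect coefficient — the resolvent looks inward along the outward similarity
transport and the cokernel functional is Gaussian-localised) (3); locally continuous in `β` for fixed data (4).  Surjectivity of
the bordered operator is the profile-level form of rate transversality (`Z_β ∉ Range 𝓛`, i.e. semisimplicity of the symmetry
eigenvalue, kit §10.4 (1)); (3)+(4) are what S3 uses to make `β ↦ 𝓫_β(−r_β − N(W_β))` continuous for the IVT. -/
def DefectGateSpec1AG (Γ κ C₂ β₀ : ℝ) (α0 : ℝ) (U0 : ℝ → EuclideanSpace ℝ (Fin 3) → EuclideanSpace ℝ (Fin 3)) (Z : ℝ → EuclideanSpace ℝ (Fin 3) → EuclideanSpace ℝ (Fin 3)) (𝓚 : ℝ → (EuclideanSpace ℝ (Fin 3) → EuclideanSpace ℝ (Fin 3)) → EuclideanSpace ℝ (Fin 3) → EuclideanSpace ℝ (Fin 3)) (𝓠 : ℝ → (EuclideanSpace ℝ (Fin 3) → EuclideanSpace ℝ (Fin 3)) → EuclideanSpace ℝ (Fin 3) → ℝ)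 (𝓫 : ℝ → (EuclideanSpace ℝ (Fin 3) → EuclideanSpace ℝ (Fin 3)) → ℝ) : Prop :=
  (∀ β : ℝ, |β| ≤ β₀ →
    (∀ (F : EuclideanSpace ℝ (Fin 3) → EuclideanSpace ℝ (Fin 3)) (R : ℝ), YBound F R →
        XBound (𝓚 β F) (C₂ * Γ ^ κ * R) ∧ ContDiff ℝ 1 (𝓠 β F) ∧ (∀ y, |𝓠 β F y| ≤ C₂ * Γ ^ κ * R) ∧ |𝓫 β F| ≤ C₂ * Γ ^ κ * R ∧
        VectorCalculus.IsDivFree (𝓚 β F) ∧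
        ∀ y, lerayLin (α0 + β) (U0 β) (𝓚 β F) y + gradient (𝓠 β F) y + 𝓫 β F • Z β y = F y) ∧
    (∀ (F G : EuclideanSpace ℝ (Fin 3) → EuclideanSpace ℝ (Fin 3)) (s : ℝ), (∃ R, YBound F R) → (∃ R, YBound G R) →
        (𝓚 β (fun y => F y + s • G y) = fun y => 𝓚 β F y + s • 𝓚 β G y) ∧ 𝓫 β (fun y => F y + s • G y) = 𝓫 β F + s * 𝓫 β G)) ∧
  (∀ R L ε : ℝ, 0 < ε → ∃ L' δ₀ : ℝ, 0 < δ₀ ∧ ∀ β : ℝ, |β| ≤ β₀ →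
      ∀ F : EuclideanSpace ℝ (Fin 3) → EuclideanSpace ℝ (Fin 3), YBound F R → (∀ y, ‖y‖ ≤ L' → ‖F y‖ ≤ δ₀) →
        (∀ y, ‖y‖ ≤ L → ‖𝓚 β F y‖ ≤ ε ∧ ‖fderiv ℝ (𝓚 β F) y‖ ≤ ε) ∧ |𝓫 β F| ≤ ε) ∧
  (∀ β : ℝ, |β| ≤ β₀ → ∀ (F : EuclideanSpace ℝ (Fin 3) → EuclideanSpace ℝ (Fin 3)) (R L ε : ℝ), YBound F R → 0 < ε →
      ∃ δ' : ℝ, 0 < δ' ∧ ∀ β' : ℝ, |β'| ≤ β₀ → |β' - β| < δ' →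
        LocClose (𝓚 β' F) (𝓚 β F) L ε ∧ |𝓫 β' F - 𝓫 β F| ≤ ε)

/-- The crux's conclusion block with FINITE regularity (`U ∈ C²`, `P ∈ C¹`): what the closing S3 delivers before the
landed elliptic smoothing; otherwise VERBATIM `Concl1`. -/
def AlmostConcl1AG (N : ℕ) (Γ ρ η Rw : ℝ) (X : Fin N → ℝ → EuclideanSpace ℝ (Fin 3)) (u : (Fin N → ℝ → EuclideanSpace ℝ (Fin 3)) → EuclideanSpace ℝ (Fin 3) → EuclideanSpace ℝ (Fin 3)) (α₁ C₀ M : ℝ) (U : EuclideanSpace ℝ (Fin 3) → EuclideanSpace ℝ (Fin 3)) (P : EuclideanSpace ℝ (Fin 3) → ℝ) : Prop :=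
  α₁ ≠ 0 ∧ U ≠ 0 ∧ ContDiff ℝ 2 U ∧ ContDiff ℝ 1 P ∧ VectorCalculus.IsDivFree U∧(∀ y, α₁•(cross (EuclideanSpace.single 2 1) (U y)-fderiv ℝ U y (cross (EuclideanSpace.single 2 1) y))+(1/2:ℝ)•U y+(1/2:ℝ)•fderiv ℝ U y y-(Laplacian.laplacian U) y+fderiv ℝ U y (U y)+gradient P y = 0)∧(∀ y, ‖U y‖≤C₀/(1+‖y‖))∧(∀ y, |P y|≤M)∧(∀ y, ‖y‖≤Rw*√Γ → (∀ j τ, ρ*√Γ/4≤‖y-X j τ‖) → ‖U y-u X y‖≤η*√Γ)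



/-! ## 3. The five statements of the line -/

/-- **Statement of stub S0 · `RateSelection1AG` (size M–L; KILL-FIRST #1; skeleton level, MODEL-checkable).**  FIRST-ORDER RATE
SELECTION with polynomial loss: for every admissible skeleton, the conditional a-priori bound of clause 13-J continues to hold
when the linearised in-ball filament-equilibrium map is AUGMENTED by the rate column `dα ↦ −dα·P_n(e₃ × X_j(τ))` (the
`α`-derivative of `T` at the skeleton; `P_n` = projection off the unit tangent) and the defect is measured IN THE BALL
`‖X j τ‖ ≤ Rb√(Γ log Γ)` only: phase-orthogonal ball-supported normal variations `Y` AND the rate increment `dα` are both controlled,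
`‖Y j τ‖ ≤ cR Γ^q · L · (1+|τ−c j|)^b` and `|dα|·√Γ ≤ cR Γ^q · L`.  Equivalently: the in-ball rate column is polynomially
transversal to the range of the phase-orthogonal linearised skeleton operator — the skeleton-level form of `⟨ψ*, 𝓡U⟩ ≠ 0`.
`q, cR` depend on the box constants only. -/
def RateSelection1AG : Prop :=
  ∀ (N : ℕ) (δ ρ K Λ a b cnd η Rw Rb cg θ₀ KA : ℝ), 0 < N → 0 < δ → 0 < ρ → 0 ≤ a → 0 < η → 0 < Rw → 0 < Rb → 0 < cg → 0 < θ₀ →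
    ∃ q cR Γ₁ : ℝ, 0 < cR ∧ ∀ Γ : ℝ, Γ₁ ≤ Γ → ∀ (γ : Fin N → ℝ) (α : ℝ) (X : Fin N → ℝ → EuclideanSpace ℝ (Fin 3)) (w : Fin N → ℝ → ℝ) (c : Fin N → ℝ) (m n : Fin N → EuclideanSpace ℝ (Fin 3)) (Aa : Fin N → ℝ → ℝ) (u : (Fin N → ℝ → EuclideanSpace ℝ (Fin 3)) → EuclideanSpace ℝ (Fin 3) → EuclideanSpace ℝ (Fin 3)) (v : EuclideanSpace ℝ (Fin 3) → EuclideanSpace ℝ (Fin 3)) (A : Fin N → (EuclideanSpace ℝ (Fin 3) →L[ℝ] EuclideanSpace ℝ (Fin 3))) (T : (Fin N → ℝ → EuclideanSpace ℝ (Fin 3)) → Fin N → ℝ → EuclideanSpace ℝ (Fin 3)),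
      DefU1 N Γ γ Aa u → DefV1 N α X u v → DefA1 N X c v A → DefT1 N α u T → Clauses1G N Γ δ ρ K Λ a b cnd Rw Rb cg θ₀ KA γ α X w c m n Aa v A T →
      ∀ Y : Fin N → ℝ → EuclideanSpace ℝ (Fin 3), (∀ j, ContDiff ℝ 2 (Y j)) → (∀ j τ, ⟪Y j τ, deriv (X j) τ⟫_ℝ = 0) →
        (∀ j τ, Rb * √(Γ * Real.log Γ) < ‖X j τ‖ → Y j τ = 0) →
        ∑ j, ⟪Y j (c j), cross (EuclideanSpace.single 2 1) (X j (c j))⟫_ℝ = 0 →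
        (∀ j τ, ‖Y j τ‖ + ‖deriv (Y j) τ‖ + ‖iteratedDeriv 2 (Y j) τ‖ ≤ (1 + |τ - c j|) ^ b) →
        ∀ dα L : ℝ,
          (∀ j τ, ‖X j τ‖ ≤ Rb * √(Γ * Real.log Γ) →
            ‖deriv (fun s : ℝ => T (fun k σ => X k σ + s • Y k σ) j τ) 0
                - dα • (cross (EuclideanSpace.single 2 1) (X j τ)
                        - ⟪cross (EuclideanSpace.single 2 1) (X j τ), deriv (X j) τ⟫_ℝ • deriv (X j) τ)‖
              ≤ L * (1 + |τ - c j|) ^ a) →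
          (∀ j τ, ‖Y j τ‖ ≤ cR * Γ ^ q * L * (1 + |τ - c j|) ^ b) ∧ |dα| * √Γ ≤ cR * Γ ^ q * L

/-- **Conclusion of stub S1** — existence of the re-wound defect family (spec `FamilySpec1AG`) for EVERY requested window exponent
`q₁` and order `k`, with size constant `Cs` uniform in both; residual constant `Cr` and threshold `Γ₁` may depend on `q₁, k`. -/
def DefectFamily1AG : Prop :=
  ∀ (N : ℕ) (δ ρ K Λ a b cnd η Rw Rb cg θ₀ KA : ℝ), 0 < N → 0 < δ → 0 < ρ → 0 ≤ a → 0 < η → 0 < Rw → 0 < Rb → 0 < cg → 0 < θ₀ →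
    ∃ Cs : ℝ, ∀ (q₁ : ℝ) (k : ℕ), ∃ Cr Γ₁ : ℝ, ∀ Γ : ℝ, Γ₁ ≤ Γ → ∀ (γ : Fin N → ℝ) (α : ℝ) (X : Fin N → ℝ → EuclideanSpace ℝ (Fin 3)) (w : Fin N → ℝ → ℝ) (c : Fin N → ℝ) (m n : Fin N → EuclideanSpace ℝ (Fin 3)) (Aa : Fin N → ℝ → ℝ) (u : (Fin N → ℝ → EuclideanSpace ℝ (Fin 3)) → EuclideanSpace ℝ (Fin 3) → EuclideanSpace ℝ (Fin 3)) (v : EuclideanSpace ℝ (Fin 3) → EuclideanSpace ℝ (Fin 3)) (A : Fin N → (EuclideanSpace ℝ (Fin 3) →L[ℝ] EuclideanSpace ℝ (Fin 3))) (T : (Fin N → ℝ → EuclideanSpace ℝ (Fin 3)) → Fin N → ℝ → EuclideanSpace ℝ (Fin 3)),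
      DefU1 N Γ γ Aa u → DefV1 N α X u v → DefA1 N X c v A → DefT1 N α u T → Clauses1G N Γ δ ρ K Λ a b cnd Rw Rb cg θ₀ KA γ α X w c m n Aa v A T →
      ∃ (α0 β₀ : ℝ) (U0 : ℝ → EuclideanSpace ℝ (Fin 3) → EuclideanSpace ℝ (Fin 3)) (P0 : ℝ → EuclideanSpace ℝ (Fin 3) → ℝ) (Z : ℝ → EuclideanSpace ℝ (Fin 3) → EuclideanSpace ℝ (Fin 3)) (g : ℝ → ℝ) (r : ℝ → EuclideanSpace ℝ (Fin 3) → EuclideanSpace ℝ (Fin 3)),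
        FamilySpec1AG N Γ ρ η Rw Rb θ₀ k Cs Cr q₁ α X u α0 β₀ U0 P0 Z g r

/-- **Statement of stub S1 · `FamilyDressing1AG` (size XL; matched asymptotics to every order with ORDER-BY-ORDER RATE CORRECTIONS —
each order's solvability in the rotation-cokernel direction is met by the rate, which is where `RateSelection1AG` is consumed —
then re-winding of the ends at the frame rate `α⁰+β` and the forced window `g(β)·Z_β`).** -/
def FamilyDressing1AG : Prop :=
  RateSelection1AG → DefectFamily1AG

/-- **Conclusion of stub S2b** — around EVERY re-wound defect family with sufficiently narrow window `q₁ ≥ q₀` and sufficiently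
high order `k ≥ k₀` (size `Cs`) there is a defect-bordered frozen-rate gate (spec `DefectGateSpec1AG`) with exponent `κ` and
constant `C₂` depending on the box constants and `Cs` only — not on `Γ`, the skeleton, the family, `q₁` or `k`. -/
def DefectGate1AG : Prop :=
  ∀ (N : ℕ) (δ ρ K Λ a b cnd η Rw Rb cg θ₀ KA : ℝ), 0 < N → 0 < δ → 0 < ρ → 0 ≤ a → 0 < η → 0 < Rw → 0 < Rb → 0 < cg → 0 < θ₀ →
    ∀ Cs : ℝ, ∃ κ C₂ q₀ : ℝ, ∃ k₀ : ℕ, ∀ q₁ : ℝ, q₀ ≤ q₁ → ∀ k : ℕ, k₀ ≤ k → 1 ≤ k → ∀ Cr : ℝ, ∃ Γ₁ : ℝ, ∀ Γ : ℝ, Γ₁ ≤ Γ → ∀ (γ : Fin N → ℝ) (α : ℝ) (X : Fin N → ℝ → EuclideanSpace ℝ (Fin 3)) (w : Fin N → ℝ → ℝ) (c : Fin N → ℝ) (m n : Fin N → EuclideanSpace ℝ (Fin 3)) (Aa : Fin N → ℝ → ℝ) (u : (Fin N → ℝ → EuclideanSpace ℝ (Fin 3)) → EuclideanSpace ℝ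 (Fin 3) → EuclideanSpace ℝ (Fin 3)) (v : EuclideanSpace ℝ (Fin 3) → EuclideanSpace ℝ (Fin 3)) (A : Fin N → (EuclideanSpace ℝ (Fin 3) →L[ℝ] EuclideanSpace ℝ (Fin 3))) (T : (Fin N → ℝ → EuclideanSpace ℝ (Fin 3)) → Fin N → ℝ → EuclideanSpace ℝ (Fin 3)),
      DefU1 N Γ γ Aa u → DefV1 N α X u v → DefA1 N X c v A → DefT1 N α u T → Clauses1G N Γ δ ρ K Λ a b cnd Rw Rb cg θ₀ KA γ α X w c m n Aa v A T →
      ∀ (α0 β₀ : ℝ) (U0 : ℝ → EuclideanSpace ℝ (Fin 3) → EuclideanSpace ℝ (Fin 3)) (P0 : ℝ → EuclideanSpace ℝ (Fin 3) → ℝ) (Z : ℝ → EuclideanSpace ℝ (Fin 3) → EuclideanSpace ℝ (Fin 3)) (g : ℝ → ℝ) (r : ℝ → EuclideanSpace ℝ (Fin 3) → EuclideanSpace ℝ (Fin 3)),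
        FamilySpec1AG N Γ ρ η Rw Rb θ₀ k Cs Cr q₁ α X u α0 β₀ U0 P0 Z g r →
      ∃ (𝓚 : ℝ → (EuclideanSpace ℝ (Fin 3) → EuclideanSpace ℝ (Fin 3)) → EuclideanSpace ℝ (Fin 3) → EuclideanSpace ℝ (Fin 3)) (𝓠 : ℝ → (EuclideanSpace ℝ (Fin 3) → EuclideanSpace ℝ (Fin 3)) → EuclideanSpace ℝ (Fin 3) → ℝ) (𝓫 : ℝ → (EuclideanSpace ℝ (Fin 3) → EuclideanSpace ℝ (Fin 3)) → ℝ),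
        DefectGateSpec1AG Γ κ C₂ β₀ α0 U0 Z 𝓚 𝓠 𝓫

/-- **Statement of stub S3 · `DefectClosing1AG` (size L; frozen-rate contraction at each `β` + CONTINUITY in `β` + the
intermediate-value theorem on the scalar defect).**  Given the size `Cs`, the gate's `κ, C₂` and ANY thresholds `q₀, k₀`, SOME
window exponent `q₁ ≥ q₀` and order `k ≥ k₀` (`k > κ + q₁ + 6`) suffice: for every family of that order and every defect gate around it, for `Γ ≥ Γ₁`, at each `|β| ≤ β₀` the map
`G ↦ −r_β − D(𝓚_β G)[𝓚_β G]` has a fixed point `G_β` in a Y-ball of radius `2Cr Γ^(−k)`, `β ↦ b_β := 𝓫_β G_β` is continuous with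
`|b_β| < Γ^(−q₁)`, so `g(β*) + b_(β*) = 0` for some `β*` in the window; then `α₁ = α⁰ + β* ≠ 0`, `U = U⁰_(β*) + 𝓚 G`, `P = P⁰ + 𝓠 G`
satisfy the crux's conclusion with `C²/C¹` regularity (`U ≠ 0` from the non-degeneracy point `y₀`). -/
def DefectClosing1AG : Prop :=
  ∀ (N : ℕ) (δ ρ K Λ a b cnd η Rw Rb cg θ₀ KA : ℝ), 0 < N → 0 < δ → 0 < ρ → 0 ≤ a → 0 < η → 0 < Rw → 0 < Rb → 0 < cg → 0 < θ₀ →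
    ∀ Cs κ C₂ q₀ : ℝ, ∀ k₀ : ℕ, ∃ q₁ : ℝ, q₀ ≤ q₁ ∧ ∃ k : ℕ, k₀ ≤ k ∧ 1 ≤ k ∧ ∀ Cr : ℝ, ∃ Γ₁ : ℝ, ∀ Γ : ℝ, Γ₁ ≤ Γ → ∀ (γ : Fin N → ℝ) (α : ℝ) (X : Fin N → ℝ → EuclideanSpace ℝ (Fin 3)) (w : Fin N → ℝ → ℝ) (c : Fin N → ℝ) (m n : Fin N → EuclideanSpace ℝ (Fin 3)) (Aa : Fin N → ℝ → ℝ) (u : (Fin N → ℝ → EuclideanSpace ℝ (Fin 3)) → EuclideanSpace ℝ (Fin 3) → EuclideanSpace ℝ (Fin 3)) (v : EuclideanSpace ℝ (Fin 3) → EuclideanSpace ℝ (Fin 3)) (A : Fin N → (EuclideanSpace ℝ (Fin 3) →L[ℝ] EuclideanSpace ℝ (Fin 3))) (T : (Fin N → ℝ → EuclideanSpace ℝ (Fin 3)) → Fin N → ℝ → EuclideanSpace ℝ (Fin 3)),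
      DefU1 N Γ γ Aa u → DefV1 N α X u v → DefA1 N X c v A → DefT1 N α u T → Clauses1G N Γ δ ρ K Λ a b cnd Rw Rb cg θ₀ KA γ α X w c m n Aa v A T →
      ∀ (α0 β₀ : ℝ) (U0 : ℝ → EuclideanSpace ℝ (Fin 3) → EuclideanSpace ℝ (Fin 3)) (P0 : ℝ → EuclideanSpace ℝ (Fin 3) → ℝ) (Z : ℝ → EuclideanSpace ℝ (Fin 3) → EuclideanSpace ℝ (Fin 3)) (g : ℝ → ℝ) (r : ℝ → EuclideanSpace ℝ (Fin 3) → EuclideanSpace ℝ (Fin 3)),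
        FamilySpec1AG N Γ ρ η Rw Rb θ₀ k Cs Cr q₁ α X u α0 β₀ U0 P0 Z g r →
      ∀ (𝓚 : ℝ → (EuclideanSpace ℝ (Fin 3) → EuclideanSpace ℝ (Fin 3)) → EuclideanSpace ℝ (Fin 3) → EuclideanSpace ℝ (Fin 3)) (𝓠 : ℝ → (EuclideanSpace ℝ (Fin 3) → EuclideanSpace ℝ (Fin 3)) → EuclideanSpace ℝ (Fin 3) → ℝ) (𝓫 : ℝ → (EuclideanSpace ℝ (Fin 3) → EuclideanSpace ℝ (Fin 3)) → ℝ),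
        DefectGateSpec1AG Γ κ C₂ β₀ α0 U0 Z 𝓚 𝓠 𝓫 →
      ∃ (α₁ C₀ M : ℝ) (U : EuclideanSpace ℝ (Fin 3) → EuclideanSpace ℝ (Fin 3)) (P : EuclideanSpace ℝ (Fin 3) → ℝ), AlmostConcl1AG N Γ ρ η Rw X u α₁ C₀ M U P


/-! ### 3⁺. LEAD RESHAPE (ns-filament-21221-p1 g9, LEAD of 27853 per DIRECTOR-NS #238, 2026-08-28): S3 split into S3a + S3b

`DefectClosing1AG` (S3, size L) has two halves of different nature: (S3b) the TOPOLOGICAL half — continuity on the closed rate window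
of the scalar defect coefficient `β ↦ 𝓫_β G_β` of the frozen-rate fixed points, from gate tightness (3), local continuity (4) and the
family's local continuity in `β`; and (S3a) the ANALYTIC/ALGEBRAIC half — per-β contraction (landed coarse Picard
`KelvinGate.picard_exists_fixedPoint`), thresholds, IVT on `g − b`, and the conclusion bookkeeping.  S3a is stated as
`DefectContinuity1AG → DefectClosing1AG` (same pattern as S2b), so `DefectClosing1AG` follows from the two stubs by modus ponens and
`lineGlue1AG` is untouched.  LEAD'S FLAG on S3b (see typer g30's sizing note on the old S3): clauses (3)/(4) of `DefectGateSpec1AG` are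
QUALITATIVE (ε–δ on balls); the natural proof of S3b wants a quantitative tightness `p_L(𝓚F), p_L(D𝓚F) ≤ θ·p_{L′}(F) + τ(L′)·Y(F)` with
`τ(L′) → 0` — if S3b resists as typed, the repair is to strengthen clause (3) (and hence S2b's target), not to weaken the crux. -/

/-- **Statement of stub S3b · `DefectContinuity1AG` (size M–L; the topological half of S3).**  For every re-wound family
(`FamilySpec1AG`), every defect gate around it (`DefectGateSpec1AG`) in the contraction regime `64·(C₂Γ^κ)²·(C_rΓ^(−k)) ≤ 1`, and every
family `β ↦ G_β` of frozen-rate fixed points `G_β = −r_β − D(𝓚_β G_β)[𝓚_β G_β]` lying in the Y-ball of radius `2C_rΓ^(−k)` over the window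
`|β| ≤ β₀`, the scalar defect coefficient `β ↦ 𝓫_β G_β` is continuous on the closed window `[−β₀, β₀]`. -/
def DefectContinuity1AG : Prop :=
  ∀ (N : ℕ) (Γ ρ η Rw Rb θ₀ : ℝ) (k : ℕ) (Cs Cr q₁ κ C₂ : ℝ) (α : ℝ) (X : Fin N → ℝ → EuclideanSpace ℝ (Fin 3))
    (u : (Fin N → ℝ → EuclideanSpace ℝ (Fin 3)) → EuclideanSpace ℝ (Fin 3) → EuclideanSpace ℝ (Fin 3))
    (α0 β₀ : ℝ) (U0 : ℝ → EuclideanSpace ℝ (Fin 3) → EuclideanSpace ℝ (Fin 3)) (P0 : ℝ → EuclideanSpace ℝ (Fin 3) → ℝ)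
    (Z : ℝ → EuclideanSpace ℝ (Fin 3) → EuclideanSpace ℝ (Fin 3)) (g : ℝ → ℝ) (r : ℝ → EuclideanSpace ℝ (Fin 3) → EuclideanSpace ℝ (Fin 3)),
    FamilySpec1AG N Γ ρ η Rw Rb θ₀ k Cs Cr q₁ α X u α0 β₀ U0 P0 Z g r →
    ∀ (𝓚 : ℝ → (EuclideanSpace ℝ (Fin 3) → EuclideanSpace ℝ (Fin 3)) → EuclideanSpace ℝ (Fin 3) → EuclideanSpace ℝ (Fin 3))
      (𝓠 : ℝ → (EuclideanSpace ℝ (Fin 3) → EuclideanSpace ℝ (Fin 3)) → EuclideanSpace ℝ (Fin 3) → ℝ)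
      (𝓫 : ℝ → (EuclideanSpace ℝ (Fin 3) → EuclideanSpace ℝ (Fin 3)) → ℝ),
      DefectGateSpec1AG Γ κ C₂ β₀ α0 U0 Z 𝓚 𝓠 𝓫 →
      64 * (C₂ * Γ ^ κ) ^ 2 * (Cr * Γ ^ (-(k:ℝ))) ≤ 1 →
      ∀ G : ℝ → EuclideanSpace ℝ (Fin 3) → EuclideanSpace ℝ (Fin 3),
        (∀ β : ℝ, |β| ≤ β₀ → YBound (G β) (2 * (Cr * Γ ^ (-(k:ℝ)))) ∧
          ∀ y, G β y = -r β y - fderiv ℝ (𝓚 β (G β)) y (𝓚 β (G β) y)) →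
        ContinuousOn (fun β => 𝓫 β (G β)) (Icc (-β₀) β₀)

/-- **Statement of stub S3a · `ClosingIVT1AG` (size M; the analytic half of S3): `DefectContinuity1AG → DefectClosing1AG`.**
Given the continuity of the defect coefficient (S3b): choose `q₁ := max q₀ 0`… and `k > 2κ + q₁ + 7`; for `Γ ≥ Γ₁` the landed Picard
iteration gives at each `|β| ≤ β₀` a fixed point `G_β` with `Y(G_β) ≤ 2C_rΓ^(−k)`; `|𝓫_β G_β| ≤ C₂Γ^κ·2C_rΓ^(−k) < Γ^(−q₁)` while
`g(±β₀)` clear `±Γ^(−q₁)`, so `g − b` vanishes at some `β*` (IVT, S3b); then `α₁ = α⁰ + β* ≠ 0` (`|α| ≥ θ₀`, `|α⁰−α| ≤ θ₀/4`,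
`|β*| ≤ θ₀/4`), `U = U⁰_{β*} + 𝓚G`, `P = P⁰_{β*} + 𝓠G` satisfy `AlmostConcl1AG` (`E(U⁰+W) + ∇(P⁰+Q) = (g−b)·Z = 0`; `U ≠ 0` from
the non-degeneracy point; decay, pressure bound, waist closeness as in `KelvinGate.concl1A_of_base_gate`). -/
def ClosingIVT1AG : Prop :=
  DefectContinuity1AG → DefectClosing1AG

/-! ## 4. NEW in this line: the frozen WAIST COLUMN MODEL and the sectional gate S2a -/

/-- A point of the cross-section at axial station `τ` in the orthonormal frame `(d; m, n)`: `τ d + ξ₀ m + ξ₁ n`. -/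
def secPt (d m n : EuclideanSpace ℝ (Fin 3)) (τ : ℝ) (ξ : EuclideanSpace ℝ (Fin 2)) : EuclideanSpace ℝ (Fin 3) :=
  τ • d + ξ 0 • m + ξ 1 • n

/-- The sectional weight `⟨ξ⟩² = 1 + |y|² − ⟨y, d⟩²` (`= 1 + ξ₀² + ξ₁²` at `y = secPt d m n τ ξ`): polynomial, NOT Gaussian, so
that cut-offs at sectional radius `Γ^ε` cost polynomially in the patching S2b. -/
def secWt (d y : EuclideanSpace ℝ (Fin 3)) : ℝ :=
  1 + ‖y‖ ^ 2 - ⟪y, d⟫_ℝ ^ 2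

/-- The GAUSSIAN COLUMN SWIRL of circulation `Rc` and Gaussian parameter `gam` about the unit axis `d` (viscosity 1):
`(gam·Rc/8π) φ(gam r²/4) · d × y`, `r² = |y|² − ⟨y,d⟩²`, `φ = burgersPhi` — verbatim `burgersVortexSwirl gam 1 Rc` for `d = e₃`
(Gallay–Maekawa 2016 (1.21)–(1.22)); its vorticity is the Gaussian `(gam Rc/4π) e^{−gam r²/4} d`. -/
def colSwirl (gam Rc : ℝ) (d y : EuclideanSpace ℝ (Fin 3)) : EuclideanSpace ℝ (Fin 3) :=
  (gam * Rc / (8 * Real.pi) * burgersPhi (gam * (‖y‖ ^ 2 - ⟪y, d⟫_ℝ ^ 2) / 4)) • cross d y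

/-- The FROZEN WAIST MODEL base field in the rotating Leray frame: `U⁰_col(y) = B y − ½ y + α e₃×y + colSwirl`, where `B` is the
gradient of the FRAME field `v = U + ½y − α e₃×y` at the waist (so `B − ½ + αJ` is the gradient of `U` itself): the local linear
flow of the waist plus the straight Gaussian column.  With `B d = κ d` and normal trace `3/2 − κ = −gam` the column
`e^{−gam r²/4}` is the sectional steady state (core area `4/(κ − 3/2)`, the skeleton's core-area law at `w = 0`). -/
def colBase (B : EuclideanSpace ℝ (Fin 3) →L[ℝ] EuclideanSpace ℝ (Fin 3)) (α gam Rc : ℝ) (d y : EuclideanSpace ℝ (Fin 3)) :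
    EuclideanSpace ℝ (Fin 3) :=
  B y - (1/2:ℝ) • y + α • cross (EuclideanSpace.single 2 1) y + colSwirl gam Rc d y

/-- The VORTICITY of the linearised profile operator at the column model acting on a velocity perturbation `W`:
`curl (lerayLin α U⁰_col W)` (the pressure gradient drops out under `curl`; for `W ∈ C³` all derivatives are classical). -/
def colForceVort (B : EuclideanSpace ℝ (Fin 3) →L[ℝ] EuclideanSpace ℝ (Fin 3)) (α gam Rc : ℝ) (d : EuclideanSpace ℝ (Fin 3))
    (W : EuclideanSpace ℝ (Fin 3) → EuclideanSpace ℝ (Fin 3)) (y : EuclideanSpace ℝ (Fin 3)) : EuclideanSpace ℝ (Fin 3) :=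
  curl (fun z => lerayLin α (colBase B α gam Rc d) W z) y

/-- **Statement of stub S2a · `WaistColumnGate1A` (size L; KILL-FIRST).**  SECTIONAL A-PRIORI BOUND WITH POLYNOMIAL LOSS for the
frozen waist column, uniformly over the parameter box.  For all `δ, Λ, θ₀ > 0` there are `R₀, q, C` such that for every circulation
`Rc ≥ R₀`, every orthonormal frame `(d; m, n)`, every `κ ∈ [3/2 + δ, Λ]`, every rate `|α| ≤ θ₀⁻¹`, every frame gradient `B` with
`B d = κ d`, `⟨Bm,m⟩ + ⟨Bn,n⟩ = 3/2 − κ`, `‖B‖ ≤ Λ`, and every velocity perturbation `W ∈ C³`, `div W = 0`, of finite sectional size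
(`⟨ξ⟩²|W|` and `⟨ξ⟩⁴|curl W|` bounded — qualitative membership, any bound), whose axial vorticity `⟨curl W, d⟩` has zero sectional mass
and zero sectional first moments at EVERY station `τ`:
`⟨ξ⟩⁴ |curl (lerayLin α U⁰_col W)| ≤ 1` everywhere ⟹ `⟨ξ⟩⁴ |curl W| ≤ C Rc^q` everywhere.
(Gaussian parameter `gam = κ − 3/2 ≥ δ`; the weight `⟨ξ⟩⁴` makes the sectional moments absolutely convergent, so no junk integral;
mass and displacement modes are EXCLUDED here and bordered in S2b; the tilt of `d` against `e₃` is unrestricted on purpose.) -/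
def WaistColumnGate1A : Prop :=
  ∀ δ Λ θ₀ : ℝ, 0 < δ → 0 < Λ → 0 < θ₀ → ∃ R₀ q C : ℝ, 0 < C ∧ ∀ Rc : ℝ, R₀ ≤ Rc →
    ∀ (d m n : EuclideanSpace ℝ (Fin 3)) (κ α : ℝ) (B : EuclideanSpace ℝ (Fin 3) →L[ℝ] EuclideanSpace ℝ (Fin 3)),
      Orthonormal ℝ ![d, m, n] → 3/2 + δ ≤ κ → κ ≤ Λ → |α| ≤ θ₀⁻¹ →
      B d = κ • d → ⟪B m, m⟫_ℝ + ⟪B n, n⟫_ℝ = 3/2 - κ → ‖B‖ ≤ Λ →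
      ∀ W : EuclideanSpace ℝ (Fin 3) → EuclideanSpace ℝ (Fin 3), ContDiff ℝ 3 W → VectorCalculus.IsDivFree W →
        (∃ A : ℝ, ∀ y, secWt d y * ‖W y‖ ≤ A ∧ secWt d y ^ 2 * ‖curl W y‖ ≤ A) →
        (∀ τ : ℝ, (∫ ξ : EuclideanSpace ℝ (Fin 2), ⟪curl W (secPt d m n τ ξ), d⟫_ℝ = 0) ∧
          (∫ ξ : EuclideanSpace ℝ (Fin 2), ξ 0 * ⟪curl W (secPt d m n τ ξ), d⟫_ℝ = 0) ∧
          (∫ ξ : EuclideanSpace ℝ (Fin 2), ξ 1 * ⟪curl W (secPt d m n τ ξ), d⟫_ℝ = 0)) →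
        (∀ y, secWt d y ^ 2 * ‖colForceVort B α (κ - 3/2) Rc d W y‖ ≤ 1) →
        ∀ y, secWt d y ^ 2 * ‖curl W y‖ ≤ C * Rc ^ q


/-- **Statement of stub S2b · `GateAssembly1AG` (size XL).**  PATCHING: the sectional waist gate S2a for the mass- and moment-free
part of each tube, the landed free resolvent (`Theorems.KelvinGate.free_resolvent[_sharp]`, `free_kelvin_gate_sharp`) in the outer
zone, the downstream sweep `w ∂_τ` at drift stations, and the REDUCED one-dimensional block (sectional mass / displacement
amplitudes, i.e. Kelvin `m = 1` long waves, plus the rate) inverted by clause 13-J TOGETHER WITH `RateSelection1AG` (the rate row),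
assemble into the defect-bordered gate `DefectGateSpec1AG` around every member of every re-wound family.  The judge's key risk —
Kelvin bending modes resonant with the frame rotation — lives in the reduced block and ONLY there. -/
def GateAssembly1AG : Prop :=
  RateSelection1AG → WaistColumnGate1A → DefectGate1AG


/-! ## 6. Sorry-free sanity lemmas about the model (not stubs) -/

/-- The column swirl along `e₃` IS the Literature Burgers swirl with viscosity 1. -/
theorem colSwirl_e3 (gam Rc : ℝ) (y : EuclideanSpace ℝ (Fin 3)) :
    colSwirl gam Rc (EuclideanSpace.single 2 1) y = burgersVortexSwirl gam 1 Rc y := by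
  unfold colSwirl burgersVortexSwirl
  have h1 : ⟪y, EuclideanSpace.single (2 : Fin 3) (1 : ℝ)⟫_ℝ = y 2 := by
    simp [EuclideanSpace.inner_single_right]
  have h2 : ‖y‖ ^ 2 = y 0 ^ 2 + y 1 ^ 2 + y 2 ^ 2 := by
    rw [EuclideanSpace.norm_eq, Real.sq_sqrt (Finset.sum_nonneg fun i _ => sq_nonneg _)]
    simp [Fin.sum_univ_three, Real.norm_eq_abs, sq_abs]
  have h3 : cross (EuclideanSpace.single (2 : Fin 3) (1 : ℝ)) y = rotGen y := by
    ext i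
    fin_cases i <;> simp [cross, crossProduct, rotGen, Matrix.cons_val_zero, Matrix.cons_val_one]
  rw [h1, h2, h3]
  congr 1
  ring_nf

/-- The sectional weight is at least 1 for a unit axis (Cauchy–Schwarz), so the weighted bounds of S2a are not vacuous by sign. -/
theorem one_le_secWt {d : EuclideanSpace ℝ (Fin 3)} (hd : ‖d‖ = 1) (y : EuclideanSpace ℝ (Fin 3)) : 1 ≤ secWt d y := by
  unfold secWt
  have h := abs_real_inner_le_norm y d
  rw [hd, mul_one] at h
  have h' : ⟪y, d⟫_ℝ ^ 2 ≤ ‖y‖ ^ 2 := by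
    calc ⟪y, d⟫_ℝ ^ 2 = |⟪y, d⟫_ℝ| ^ 2 := (sq_abs _).symm
      _ ≤ ‖y‖ ^ 2 := pow_le_pow_left₀ (abs_nonneg _) h 2
  linarith

/-- The rate column is the exact `β`-derivative of the profile operator: `E_(α+β)(U) = E_α(U) + β·𝓡U` pointwise (pure algebra;
this is why the defect column `Z_β = χ·𝓡U⁰_β` is the natural bordering direction and why a FROZEN base cannot carry the rate). -/
theorem lerayOp_add_rate (α β : ℝ) (U : EuclideanSpace ℝ (Fin 3) → EuclideanSpace ℝ (Fin 3)) (y : EuclideanSpace ℝ (Fin 3)) :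
    lerayOp (α + β) U y = lerayOp α U y + β • rateGen U y := by
  unfold lerayOp rateGen
  module

/-! ## 7. LEAD RESHAPE (ns-filament-21221-p1 g10, LEAD of 27853, 2026-08-28): S2a `WaistColumnGate1A` is FALSE AS TYPED (far-field
quasimodes of the frozen sectional operator under strain asymmetry `s > gam/4`; memo S2A-FALSE-FARFIELD-27853-g10.md = evidence #25 on stmt-27853;
the operator identity `colForceVort_eq` is kernel-checked in `Theorems/FilamentSkeletonRssDefectColumnGateColumnVorticity.lean`).  The defect is the
model's UNBOUNDED SECTION at fixed weight; S2b only uses the sectional gate inside its patch radius, so the repair is SECTIONAL LOCALISATION WITH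
POLYNOMIAL LOSS IN THE RADIUS: S2a-loc replaces S2a, S2b-loc replaces S2b; S0, S1, S3 and the composition are unchanged. -/

/-- **Statement of stub S2a-loc · `WaistColumnGateLoc1A` (size L; KILL-FIRST #2, replaces `WaistColumnGate1A`).**  SECTIONALLY LOCALISED
a-priori bound with polynomial loss in the circulation `Rc` AND in the localisation radius `R`: exactly the data, frame hypotheses, class
and moment conditions of `WaistColumnGate1A`, for perturbations `W` that moreover VANISH OUTSIDE THE SECTIONAL CYLINDER of radius `R ≥ 1`
about the axis `ℝd` (`|y|² − ⟨y,d⟩² ≥ R² ⟹ W(y) = 0`; S2b patches at sectional radius `Γ^ε` through vector-potential cut-offs, which keep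
`W` solenoidal and compactly supported in the section), with conclusion `⟨ξ⟩⁴|curl W| ≤ C·Rc^q·R^q`.  The far-field quasimodes that kill
`WaistColumnGate1A` only force `C·R^q ≳ log R` here. -/
def WaistColumnGateLoc1A : Prop :=
  ∀ δ Λ θ₀ : ℝ, 0 < δ → 0 < Λ → 0 < θ₀ → ∃ R₀ q C : ℝ, 0 < C ∧ ∀ Rc : ℝ, R₀ ≤ Rc → ∀ R : ℝ, 1 ≤ R →
    ∀ (d m n : EuclideanSpace ℝ (Fin 3)) (κ α : ℝ) (B : EuclideanSpace ℝ (Fin 3) →L[ℝ] EuclideanSpace ℝ (Fin 3)),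
      Orthonormal ℝ ![d, m, n] → 3/2 + δ ≤ κ → κ ≤ Λ → |α| ≤ θ₀⁻¹ →
      B d = κ • d → ⟪B m, m⟫_ℝ + ⟪B n, n⟫_ℝ = 3/2 - κ → ‖B‖ ≤ Λ →
      ∀ W : EuclideanSpace ℝ (Fin 3) → EuclideanSpace ℝ (Fin 3), ContDiff ℝ 3 W → VectorCalculus.IsDivFree W →
        (∃ A : ℝ, ∀ y, secWt d y * ‖W y‖ ≤ A ∧ secWt d y ^ 2 * ‖curl W y‖ ≤ A) →
        (∀ y, R ^ 2 ≤ ‖y‖ ^ 2 - ⟪y, d⟫_ℝ ^ 2 → W y = 0) →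
        (∀ τ : ℝ, (∫ ξ : EuclideanSpace ℝ (Fin 2), ⟪curl W (secPt d m n τ ξ), d⟫_ℝ = 0) ∧
          (∫ ξ : EuclideanSpace ℝ (Fin 2), ξ 0 * ⟪curl W (secPt d m n τ ξ), d⟫_ℝ = 0) ∧
          (∫ ξ : EuclideanSpace ℝ (Fin 2), ξ 1 * ⟪curl W (secPt d m n τ ξ), d⟫_ℝ = 0)) →
        (∀ y, secWt d y ^ 2 * ‖colForceVort B α (κ - 3/2) Rc d W y‖ ≤ 1) →
        ∀ y, secWt d y ^ 2 * ‖curl W y‖ ≤ C * Rc ^ q * R ^ q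

/-- **Statement of stub S2b-loc · `GateAssemblyLoc1AG` (size XL; replaces `GateAssembly1AG`).**  PATCHING as in `GateAssembly1AG`, consuming
the LOCALISED sectional gate: the near-tube part of a global perturbation is cut off (vector potential) at sectional radius `R = Γ^ε`, costing
`R^q = Γ^{εq}` — polynomial, as the line requires. -/
def GateAssemblyLoc1AG : Prop :=
  RateSelection1AG → WaistColumnGateLoc1A → DefectGate1AG

end Summit.NavierStokesRegularity.NavierStokesRegularity.Theorems.DefectColumnGate

end
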